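import Literature.NumberTheory.EllipticCurves.ComplexMultiplicationDeuringReductionCMEndProofs
import Literature.NumberTheory.EllipticCurves.ComplexMultiplicationDeuringReductionCoxEndProofs
import Literature.NumberTheory.EllipticCurves.ComplexMultiplicationDeuringEndReductionProofs
import Literature.NumberTheory.EllipticCurves.ComplexMultiplicationDeuringReductionSplitProofs
import HarnessLib

/-!
# Deuring's reduction isomorphism `𝓞_K = ℤ[ω_d] ≅ End_{𝔽̄_p}(Ē)` at a split prime — discharged

Topic `NumberTheory/EllipticCurves` (trunk T-ELLARITH, notion `cm_endomorphisms_isogeny`).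
A proofs-only sibling (D-0014 append protocol: no definitions, every declaration a theorem) of
`Literature.NumberTheory.EllipticCurves.ComplexMultiplicationDeuringReduction`, which states the
named fact `Deuring1941_exists_ringEquiv_cmRing_geomEndRing`: *for `E/ℚ` given by a globally
minimal `W` with `j(W) ∈ maximalCMJInvariants` (CM by the maximal order `ℤ[ω_d]`,
`d = cmDiscr (j W)`) and an odd prime `p ∤ d Δ_W` at which `d` is a square (`p` splits in
`K = ℚ(√d)`), there is a ring isomorphism `ι : ℤ[ω_d] ≃+* End_{𝔽̄_p}(Ē)`,
`Ē = reductionModPrime W p`, under which the degree of an isogeny is the norm: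
`deg ψ = α ᾱ` whenever `ψ = ι α`.* This is the isomorphism displayed in the proof of Cox's
Theorem 14.16 (PDF p. 323: "reduction induces an isomorphism `End_ℂ(E) ⥲ End_{𝔽̄_p}(Ē)` that
preserves degrees", referring to Lang, *Elliptic Functions*, Ch. 13 Thm. 12). This file proves it:

* `Deuring1941_exists_ringEquiv_cmRing_geomEndRing_holds`.

## The printed proof and the proof assembled here

Lang's proof of Ch. 13 §4 Thm. 12(ii) (PDF pp. 140–141), case `c = 1` (maximal order), split `p`:
reduction of endomorphisms `End(A) → End(Ā)` is an injective ring homomorphism preserving degrees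
(Ch. 9 §2); `Ā` is ordinary because `p` splits (Thm. 12, first assertion); hence `End(Ā)` is an
order in an imaginary quadratic field (Ch. 13 §2 Thm. 5); it contains the image of the maximal
order `𝓞_K`, so it equals it. Every step is by now a theorem of the tree, and the assembly is
`Deuring1941_exists_ringEquiv_cmRing_geomEndRing_of_facts₂`
(`ComplexMultiplicationDeuringReductionCMEndProofs`), which needs exactly two inputs:

* **(C)** `Cox2013_exists_ringEquiv_cmRing_geomEndRing` — `ι₀ : ℤ[ω_d] ≃+* End_{ℚ̄}(E)` with
  `deg = N` (Cox §14.B with Thm. 10.14, Cor. 10.20; Silverman, *Advanced Topics*, II.1–II.2):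
  discharged as `Cox2013_exists_ringEquiv_cmRing_geomEndRing_holds`
  (`ComplexMultiplicationDeuringReductionCoxEndProofs`: analytic representation, kernel-certified
  CM transformation polynomials for the nine `d`, transport along `j`);
* **(R)** `Silverman1994_exists_reduction_ringHom_geomEndRing` — the injective degree-preserving
  reduction homomorphism `End_{ℚ̄}(E) → End_{𝔽̄_p}(Ē)` (Silverman, *Advanced Topics*,
  Prop. II.4.4; Lang Ch. 9 §2): discharged as
  `Silverman1994_exists_reduction_ringHom_geomEndRing_holds`
  (`ComplexMultiplicationDeuringEndReductionProofs`: reduction of `ℚ̄`-points and of algebraic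
  maps along a place of `ℚ̄` above `p`).

Given these, `ω = r(ι₀ ω_d) ∈ End_{𝔽̄_p}(Ē)` satisfies `ω² − dω + c = 0` (`4c = d(d − 1)`), `Ē`
has a point of order `p` (`WeierstrassCurve.exists_ne_zero_nsmul_eq_zero_of_cmEnd`, the split
ordinary criterion), so `End_{𝔽̄_p}(Ē)` is commutative, an order in an imaginary quadratic field
containing the maximal order `ℤ[ω]`, whence `ℤ[ω_d] ≃+* End_{𝔽̄_p}(Ē)` with `deg = N`
(`exists_ringEquiv_cmRing_geomEndRing_of_cmEnd`). For the record the original four-fact assembly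
of the parent file, `Deuring1941_exists_ringEquiv_cmRing_geomEndRing_of_facts` (inputs (C), (R),
(D1) `Deuring1941_exists_pTorsion_reduction_of_split`, (D2)
`Lang1987_geomEndRing_isOrder_of_exists_pTorsion`), is also closed here from the four discharges
(`Deuring1941_exists_ringEquiv_cmRing_geomEndRing_holds'`), all four facts being theorems of the
tree (`…SplitProofs`, `…OrdinaryProofs`). Cox's Theorem 14.16 itself (`a_p = π + π̄`,
`p = π π̄`; the named fact `Deuring1941_frobeniusTrace_eq_add_conj`, already a theorem of the tree
by the `ℓ`-adic route of `ComplexMultiplicationDeuringFrobeniusProofs`) now also follows along the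
printed route as the term
`Deuring1941_frobeniusTrace_eq_add_conj_of_exists_ringEquiv Deuring1941_exists_ringEquiv_cmRing_geomEndRing_holds`
(Cox's own assembly, proved in the parent file; not restated here).

## References

* D. A. Cox, *Primes of the form x² + ny²*, 2nd ed., Wiley (2013), §14.C Thm. 14.16 and its proof
  (PDF pp. 322–323); §14.B (PDF pp. 318–321). Held: `book:cox2013-primes-form-i-x-sup-2-sup`.
  [Cox2013]
* S. Lang, *Elliptic Functions*, 2nd ed., GTM 112 (1987), Ch. 13 §4 Thm. 12 and its proof
  (PDF pp. 140–141); Ch. 13 §2 Thm. 5 (PDF p. 134); Ch. 9 §2 (PDF pp. 83–84). Held: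
  `book:lang1987-elliptic-functions`. [Lang1987]
* M. Deuring, *Die Typen der Multiplikatorenringe elliptischer Funktionenkörper*, Abh. Math. Sem.
  Univ. Hamburg 14 (1941), 197–272. [Deuring1941]
* J. H. Silverman, *Advanced Topics in the Arithmetic of Elliptic Curves*, GTM 151 (1994),
  Prop. II.4.4, Thm. II.2.2. [SilvermanAdvancedTopics1994]
-/

namespace Literature.NumberTheory.EllipticCurves

/-- **Deuring's reduction isomorphism (Deuring 1941; Lang, *Elliptic Functions*, Ch. 13 §4
Thm. 12(ii); the isomorphism displayed in the proof of Cox's Thm. 14.16), discharged**: for `E/ℚ`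
given by a globally minimal `W` with `j(W) ∈ maximalCMJInvariants`, `d = cmDiscr (j W)`, and an odd
prime `p ∤ d Δ_W` with `d` a square mod `p`, there is a ring isomorphism
`ι : ℤ[ω_d] ≃+* End_{𝔽̄_p}(reductionModPrime W p)` with `deg ψ = α ᾱ` whenever `ψ = ι α`.
Proof: `Deuring1941_exists_ringEquiv_cmRing_geomEndRing_of_facts₂` (Lang's proof of Thm. 12(ii),
`c = 1`) fed with the two discharged inputs `Cox2013_exists_ringEquiv_cmRing_geomEndRing_holds`
(`End_{ℚ̄}(E) ≅ ℤ[ω_d]`, `deg = N`) and `Silverman1994_exists_reduction_ringHom_geomEndRing_holds`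
(injective degree-preserving reduction of endomorphisms).
[cite: Cox2013, Thm. 14.16, proof (§14.C, PDF p. 323)]
[cite: Lang1987, Ch. 13 §4 Thm. 12(ii) and its proof (PDF pp. 140–141)] [cite: Deuring1941] -/
theorem Deuring1941_exists_ringEquiv_cmRing_geomEndRing_holds :
    Deuring1941_exists_ringEquiv_cmRing_geomEndRing :=
  Deuring1941_exists_ringEquiv_cmRing_geomEndRing_of_facts₂
    Cox2013_exists_ringEquiv_cmRing_geomEndRing_holds
    Silverman1994_exists_reduction_ringHom_geomEndRing_holds

/-- **The parent file's four-fact assembly, closed**: Deuring's reduction isomorphism by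
`Deuring1941_exists_ringEquiv_cmRing_geomEndRing_of_facts` (`ComplexMultiplicationDeuringReductionProofs`)
from the discharges of all four of its inputs — (C) `Cox2013_exists_ringEquiv_cmRing_geomEndRing_holds`,
(R) `Silverman1994_exists_reduction_ringHom_geomEndRing_holds`, (D1)
`Deuring1941_exists_pTorsion_reduction_of_split_holds` (the reduction at a split prime is
ordinary), (D2) `Lang1987_geomEndRing_isOrder_of_exists_pTorsion_holds` (the geometric
endomorphism ring of an ordinary curve is an imaginary quadratic order).
[cite: Lang1987, Ch. 13 §4 Thm. 12 and its proof (PDF pp. 140–141); Ch. 13 §2 Thm. 5 (PDF p. 134)] -/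
theorem Deuring1941_exists_ringEquiv_cmRing_geomEndRing_holds' :
    Deuring1941_exists_ringEquiv_cmRing_geomEndRing :=
  Deuring1941_exists_ringEquiv_cmRing_geomEndRing_of_facts
    Cox2013_exists_ringEquiv_cmRing_geomEndRing_holds
    Silverman1994_exists_reduction_ringHom_geomEndRing_holds
    Deuring1941_exists_pTorsion_reduction_of_split_holds
    Lang1987_geomEndRing_isOrder_of_exists_pTorsion_holds

end Literature.NumberTheory.EllipticCurves
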